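import Literature.MathematicalPhysics.QuantumLattice.FreeFermiGasPairingCostUniform

/-!
# Crux `NoOnsiteODLRO` (stmt-HubbardSuperconductivity-0933) — helper: pair LRO of ANY form factor costs
# free kinetic energy at the level-uniform rate `a/(10⁵ log²(4 + 32/√a))` (deviation-hypothesis form)

`--supports stmt-HubbardSuperconductivity-0933` (routes `LiebTwin`, `EnslavedA1g`). The tree's pairing-cost
theorem `freeDWavePairing_costs_energy_uniform_explicit` (`Literature/…/FreeFermiGasPairingCostUniform.lean`,
rate `a/(10⁵·log²(4 + 32/√a))` at EVERY filling) uses its `d`-wave hypothesis `Re ⟨ψ, Δ_d†Δ_d ψ⟩ ≥ a·L⁴` at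
exactly one place: Step 1, the triangle bound
`√(a/8)·L² ≤ 2 Σ_{k∉F} √x_k + 2 Σ_{k∈F} √(1 - x_k) + 2 √(Σ_{k∈F} x_k)` (`x_k = Re ⟨ψ, n_{k↑} ψ⟩`) of
`sqrt_le_deviation_of_le_re_expect_pairField_dWave`. This file re-runs the same proof with that triangle
bound as the HYPOTHESIS (`freePairing_costs_energy_uniform_of_deviation`, proof adapted verbatim from the
Literature file, one line changed), and derives the form for an arbitrary bounded real form factor
(`freePairing_costs_energy_uniform_pairOperator`: `Re ⟨ψ, B(ĝ)†B(ĝ) ψ⟩ ≥ q·L⁴`, `|ĝ| ≤ G`, rate parameter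
`a = 32q/G²`), so that the ON-SITE (`s`-wave, `ĝ ≡ 1`) channel of the crux — and the extended-`s` one — get
the same weak-coupling ceiling as the `d`-wave channel (`HubbardPairDensityCouplingCeilingUniform.lean`);
consumer: `LiebTwinNoOnsiteODLROWeakCouplingOnsiteCeiling.lean`.

Sources: J. Bardeen, L. N. Cooper, J. R. Schrieffer, Phys. Rev. 108 (1957) 1175, §II–III; L. Van Hove,
Phys. Rev. 89 (1953) 1189; C. N. Yang, Rev. Mod. Phys. 34 (1962) 694, §3. Folklore finite-dimensional
statements; no named facts, no definitions.

Tree search: `freeDWavePairing_costs_energy_uniform_explicit` (the `d`-wave instance, whose proof is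
adapted here), `exists_fermiSet_deviation_le_energy_excess`, `card_torusShell_lt_le_log`,
`sum_inv_abs_sub_le_log_sq`, `log_four_ge`, `sqrt_re_expect_pairOperator_le_deviation`.
-/

noncomputable section

set_option linter.dupNamespace false

namespace Summit.HubbardSuperconductivity.HubbardSuperconductivity.Theorems.NoOnsiteODLRO.OnsiteCeiling

open Matrix Finset Literature.Probability.LatticeModels Literature.MathematicalPhysics.QuantumLattice
open scoped ComplexOrder ComplexConjugate

variable {L : ℕ} [NeZero L]

/-- **Pair LRO costs kinetic energy — level-uniform logarithmic rate, deviation-hypothesis form.** For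
`a > 0`, `L ≥ 3` with `√a·L ≥ 3200`, a unit vector `ψ ∈ szSector (2n) 0` (any `n`) whose `↑`-occupations
`x_k = Re ⟨ψ, n_{k↑} ψ⟩` satisfy, for EVERY finite set `F` of momenta, the triangle bound
`√(a/8)·L² ≤ 2 Σ_{k∉F} √x_k + 2 Σ_{k∈F} √(1 - x_k) + 2 √(Σ_{k∈F} x_k)` (as forced by `d`-wave pair density
`a`, `sqrt_le_deviation_of_le_re_expect_pairField_dWave`, or by on-site pair density `a/16`, see the
consumer file): `minEnergyOn H₀ (szSector (2n) 0) + a/(10⁵·log²(4 + 32/√a))·L² ≤ Re ⟨ψ, H₀ ψ⟩`,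
`H₀ = hubbardTorus 2 L 1 0`. Proof = the proof of `freeDWavePairing_costs_energy_uniform_explicit`
(adapted from `Literature/MathematicalPhysics/QuantumLattice/FreeFermiGasPairingCostUniform.lean`; only
Step 1 reads the hypothesis): exact bathtub deviation bound `Σ|ξ|dev ≤ K`, van-Hove-safe window count,
uniform logarithmic inverse-gap sum, one Cauchy–Schwarz. Bardeen–Cooper–Schrieffer (1957) §II;
Van Hove (1953). [folklore] -/
theorem freePairing_costs_energy_uniform_of_deviation {a : ℝ} (ha : 0 < a) (hL : 3 ≤ L)
    (hLa : 3200 ≤ Real.sqrt a * L) {n : ℕ} {ψ : Fock (Orb (FermionTorus 2 L))}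
    (hψ : ψ ∈ szSector (Λ := FermionTorus 2 L) (2 * n) 0) (h1 : star ψ ⬝ᵥ ψ = 1)
    (htri : ∀ F : Finset (TorusSite 2 L), Real.sqrt (a / 8) * (L : ℝ) ^ 2 ≤
      2 * ∑ k ∈ Fᶜ, Real.sqrt ((star ψ ⬝ᵥ (momentumNumber k 0 *ᵥ ψ)).re) +
        2 * ∑ k ∈ F, Real.sqrt (1 - (star ψ ⬝ᵥ (momentumNumber k 0 *ᵥ ψ)).re) +
          2 * Real.sqrt (∑ k ∈ F, (star ψ ⬝ᵥ (momentumNumber k 0 *ᵥ ψ)).re)) :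
    (hubbardTorus 2 L 1 0).minEnergyOn (szSector (Λ := FermionTorus 2 L) (2 * n) 0) +
        a / (100000 * Real.log (4 + 32 / Real.sqrt a) ^ 2) * (L : ℝ) ^ 2 ≤
      (star ψ ⬝ᵥ (hubbardTorus 2 L 1 0 *ᵥ ψ)).re := by
  classical
  obtain ⟨F, eF, hFc, hF, hF', hdev⟩ := exists_fermiSet_deviation_le_energy_excess hL hψ h1
  -- occupations and deviations
  obtain ⟨x, hx⟩ : ∃ x : TorusSite 2 L → ℝ, ∀ k, (star ψ ⬝ᵥ (momentumNumber k 0 *ᵥ ψ)).re = x k :=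
    ⟨_, fun _ => rfl⟩
  simp only [hx] at hdev
  have hx0 : ∀ k, 0 ≤ x k := fun k => by rw [← hx]; exact (re_expect_momentumNumber_mem_Icc k 0 ψ).1
  have hx1 : ∀ k, x k ≤ 1 := fun k => by
    have := (re_expect_momentumNumber_mem_Icc k 0 ψ).2
    rwa [h1, Complex.one_re, hx] at this
  set dev : TorusSite 2 L → ℝ := fun k => if k ∈ F then 1 - x k else x k with hdev_def
  have hd0 : ∀ k, 0 ≤ dev k := fun k => by
    simp only [hdev_def]; split_ifs <;> linarith [hx0 k, hx1 k]
  have hd1 : ∀ k, dev k ≤ 1 := fun k => by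
    simp only [hdev_def]; split_ifs <;> linarith [hx0 k, hx1 k]
  set K : ℝ := (star ψ ⬝ᵥ (hubbardTorus 2 L 1 0 *ᵥ ψ)).re -
    (hubbardTorus 2 L 1 0).minEnergyOn (szSector (Λ := FermionTorus 2 L) (2 * n) 0) with hK
  set ξ : TorusSite 2 L → ℝ := fun k => |torusBand L k - eF| with hξ
  have hξ0 : ∀ k, 0 ≤ ξ k := fun k => abs_nonneg _
  have hdevK : ∑ k, ξ k * dev k ≤ K := hdev
  have hK0 : 0 ≤ K := le_trans (Finset.sum_nonneg fun k _ => mul_nonneg (hξ0 k) (hd0 k)) hdevK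
  -- scales
  set α : ℝ := Real.sqrt (a / 8) with hα
  have hα0 : 0 < α := Real.sqrt_pos.2 (by positivity)
  have hα2 : α ^ 2 = a / 8 := Real.sq_sqrt (by positivity)
  have hL0' : (0 : ℝ) < L := by exact_mod_cast (show 0 < L by omega)
  have hL3 : (3 : ℝ) ≤ L := by exact_mod_cast hL
  have hsa : Real.sqrt a = Real.sqrt 8 * α := by
    rw [hα, ← Real.sqrt_mul (by norm_num : (0 : ℝ) ≤ 8)]
    congr 1
    ring
  have hs8 : Real.sqrt 8 ≤ 3 := by
    rw [show (3 : ℝ) = Real.sqrt (3 ^ 2) from (Real.sqrt_sq (by norm_num)).symm]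
    exact Real.sqrt_le_sqrt (by norm_num)
  have hs80 : 0 ≤ Real.sqrt 8 := Real.sqrt_nonneg _
  -- Step 1: triangle bounds `α L² ≤ 2 Σ √dev + 2L`
  have hstep1 : α * (L : ℝ) ^ 2 ≤ 2 * ∑ k, Real.sqrt (dev k) + 2 * L := by
    have h := htri F
    simp only [hx] at h
    have hS : ∑ k ∈ Fᶜ, Real.sqrt (x k) + ∑ k ∈ F, Real.sqrt (1 - x k) = ∑ k, Real.sqrt (dev k) := by
      rw [← Finset.sum_add_sum_compl F fun k => Real.sqrt (dev k), add_comm]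
      congr 1
      · exact Finset.sum_congr rfl fun k hk => by
          rw [hdev_def]; dsimp only; rw [if_pos hk]
      · exact Finset.sum_congr rfl fun k hk => by
          rw [hdev_def]; dsimp only; rw [if_neg (Finset.mem_compl.1 hk)]
    have hFx : Real.sqrt (∑ k ∈ F, x k) ≤ L := by
      have hle : ∑ k ∈ F, x k ≤ (L : ℝ) ^ 2 := by
        calc ∑ k ∈ F, x k ≤ ∑ k ∈ F, (1 : ℝ) := Finset.sum_le_sum fun k _ => hx1 k
          _ = F.card := by rw [Finset.sum_const, nsmul_eq_mul, mul_one]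
          _ ≤ (L : ℝ) ^ 2 := by
              have := Finset.card_le_univ F
              rw [card_torusSite] at this
              exact_mod_cast this
      calc Real.sqrt (∑ k ∈ F, x k) ≤ Real.sqrt ((L : ℝ) ^ 2) := Real.sqrt_le_sqrt hle
        _ = L := Real.sqrt_sq hL0'.le
    linarith
  -- `α ≤ 3` (from Step 1 and `Σ √dev ≤ L²`), hence `1/α ≤ 4 + 32/√a`
  have hsumle : ∑ k, Real.sqrt (dev k) ≤ (L : ℝ) ^ 2 := by
    calc ∑ k, Real.sqrt (dev k) ≤ ∑ _k : TorusSite 2 L, (1 : ℝ) :=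
          Finset.sum_le_sum fun k _ => by
            rw [show (1 : ℝ) = Real.sqrt 1 from Real.sqrt_one.symm]
            exact Real.sqrt_le_sqrt (hd1 k)
      _ = (L : ℝ) ^ 2 := by
          rw [Finset.sum_const, Finset.card_univ, card_torusSite, nsmul_eq_mul, mul_one]
          push_cast
          ring
  have hα3 : α ≤ 3 := by
    have h3L : 3 * (L : ℝ) ≤ (L : ℝ) ^ 2 := by
      calc 3 * (L : ℝ) ≤ L * L := mul_le_mul_of_nonneg_right hL3 hL0'.le
        _ = (L : ℝ) ^ 2 := by ring
    have h : α * (L : ℝ) ^ 2 ≤ 3 * (L : ℝ) ^ 2 := by linarith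
    exact le_of_mul_le_mul_right h (by positivity)
  set ℓ₀ : ℝ := Real.log (4 + 32 / Real.sqrt a) with hℓ₀
  have hlog4 := log_four_ge
  have hsqa0 : 0 < Real.sqrt a := Real.sqrt_pos.2 ha
  have hℓ4 : Real.log 4 ≤ ℓ₀ := by
    refine Real.log_le_log (by norm_num) ?_
    have : 0 ≤ 32 / Real.sqrt a := by positivity
    linarith
  have hℓ0 : 0 < ℓ₀ := by linarith
  have hinvα : 1 / α ≤ 4 + 32 / Real.sqrt a := by
    have h32 : 1 / α ≤ 32 / Real.sqrt a := by
      rw [hsa, div_le_div_iff₀ hα0 (by positivity)]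
      have := mul_le_mul_of_nonneg_right hs8 hα0.le
      linarith
    have : (0 : ℝ) ≤ 4 := by norm_num
    linarith
  have hlogα : Real.log (1 / α) ≤ ℓ₀ := Real.log_le_log (by positivity) hinvα
  -- Step 2: the window `e₀ = α / (512 ℓ₀)`
  set e₀ : ℝ := α / (512 * ℓ₀) with he₀
  have he0 : 0 < e₀ := by positivity
  have he1 : e₀ ≤ 1 := by
    rw [he₀, div_le_one (by positivity)]
    linarith
  have h4e : 4 / e₀ = 2048 * ℓ₀ * (1 / α) := by
    rw [he₀]
    field_simp
    ring
  have hΛ : Real.log (4 / e₀) ≤ 15 / 2 * ℓ₀ := by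
    rw [h4e, Real.log_mul (by positivity) (by positivity), Real.log_mul (by norm_num) hℓ0.ne']
    have h2048 : Real.log 2048 = 11 * Real.log 2 := by
      rw [show (2048 : ℝ) = 2 ^ 11 by norm_num, Real.log_pow]; norm_num
    have hl4 : Real.log 4 = 2 * Real.log 2 := by
      rw [show (4 : ℝ) = 2 ^ 2 by norm_num, Real.log_pow]; norm_num
    have hlogℓ : Real.log ℓ₀ ≤ ℓ₀ - 1 := Real.log_le_sub_one_of_pos hℓ0
    rw [h2048]
    rw [hl4] at hℓ4
    linarith
  have hΛ0 : 0 ≤ Real.log (4 / e₀) := by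
    refine Real.log_nonneg ?_
    rw [le_div_iff₀ he0]; linarith
  -- the window holds few momenta (van-Hove-safe count)
  have hwindow : ∑ k ∈ Finset.univ.filter (fun k => ¬ e₀ ≤ ξ k), Real.sqrt (dev k) ≤
      α / 10 * (L : ℝ) ^ 2 + 52 * L := by
    calc ∑ k ∈ Finset.univ.filter (fun k => ¬ e₀ ≤ ξ k), Real.sqrt (dev k)
        ≤ ∑ k ∈ Finset.univ.filter (fun k => ¬ e₀ ≤ ξ k), (1 : ℝ) :=
          Finset.sum_le_sum fun k _ => by
            rw [show (1 : ℝ) = Real.sqrt 1 from Real.sqrt_one.symm]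
            exact Real.sqrt_le_sqrt (hd1 k)
      _ = ((Finset.univ.filter (fun k => ¬ e₀ ≤ ξ k)).card : ℝ) := by
          rw [Finset.sum_const, nsmul_eq_mul, mul_one]
      _ = ((Finset.univ.filter (fun k : TorusSite 2 L => |torusBand L k - eF| < e₀)).card : ℝ) := by
          congr 2
          refine Finset.filter_congr fun k _ => ?_
          rw [hξ, not_le]
      _ ≤ 6 * e₀ * Real.log (4 / e₀) * (L : ℝ) ^ 2 + 52 * L := card_torusShell_lt_le_log he0 he1 eF
      _ ≤ α / 10 * (L : ℝ) ^ 2 + 52 * L := by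
          have h6 : 6 * e₀ * Real.log (4 / e₀) ≤ α / 10 := by
            calc 6 * e₀ * Real.log (4 / e₀) ≤ 6 * e₀ * (15 / 2 * ℓ₀) :=
                  mul_le_mul_of_nonneg_left hΛ (by positivity)
              _ = 45 / 512 * α := by
                  rw [he₀]
                  field_simp
                  ring
              _ ≤ α / 10 := by linarith
          have := mul_le_mul_of_nonneg_right h6 (sq_nonneg (L : ℝ))
          linarith
  -- outside the window: Cauchy–Schwarz against the uniform logarithmic inverse-gap sum
  set W : ℝ := 20 * (L : ℝ) ^ 2 * Real.log (4 / e₀) ^ 2 + 70 * L / e₀ with hW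
  have hW0 : 0 ≤ W := by positivity
  have houtside : ∑ k ∈ Finset.univ.filter (fun k => e₀ ≤ ξ k), Real.sqrt (dev k) ≤
      Real.sqrt K * Real.sqrt W := by
    have hcs := Real.sum_sqrt_mul_sqrt_le (Finset.univ.filter (fun k => e₀ ≤ ξ k))
      (f := fun k => ξ k * dev k) (g := fun k => 1 / ξ k)
      (fun k => mul_nonneg (hξ0 k) (hd0 k)) (fun k => by positivity)
    have heq : ∀ k ∈ Finset.univ.filter (fun k => e₀ ≤ ξ k),
        Real.sqrt (dev k) = Real.sqrt (ξ k * dev k) * Real.sqrt (1 / ξ k) := by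
      intro k hk
      have hk' : 0 < ξ k := lt_of_lt_of_le he0 (Finset.mem_filter.1 hk).2
      rw [← Real.sqrt_mul (mul_nonneg (hξ0 k) (hd0 k)), mul_comm (ξ k), mul_assoc,
        mul_one_div_cancel hk'.ne', mul_one]
    rw [Finset.sum_congr rfl heq]
    refine hcs.trans (mul_le_mul ?_ ?_ (Real.sqrt_nonneg _) (Real.sqrt_nonneg _))
    · refine Real.sqrt_le_sqrt (le_trans ?_ hdevK)
      exact Finset.sum_le_sum_of_subset_of_nonneg (Finset.filter_subset _ _)
        fun k _ _ => mul_nonneg (hξ0 k) (hd0 k)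
    · exact Real.sqrt_le_sqrt ((sum_inv_abs_sub_le_log_sq (L := L) eF he0 he1).trans (le_of_eq rfl))
  have hsplit : ∑ k, Real.sqrt (dev k) =
      ∑ k ∈ Finset.univ.filter (fun k => e₀ ≤ ξ k), Real.sqrt (dev k) +
        ∑ k ∈ Finset.univ.filter (fun k => ¬ e₀ ≤ ξ k), Real.sqrt (dev k) :=
    (Finset.sum_filter_add_sum_filter_not _ _ _).symm
  -- Step 3: the threshold `α L ≥ 1060`, combine and square
  have hαL : 1060 ≤ α * L := by
    have : Real.sqrt a * L ≤ 3 * (α * L) := by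
      rw [hsa]
      have := mul_le_mul_of_nonneg_right hs8 (mul_pos hα0 hL0').le
      linarith [show Real.sqrt 8 * α * L = Real.sqrt 8 * (α * L) by ring]
    linarith
  have hmain : 7 / 10 * α * (L : ℝ) ^ 2 ≤ 2 * (Real.sqrt K * Real.sqrt W) := by
    have h106 : 106 * (L : ℝ) ≤ α / 10 * (L : ℝ) ^ 2 := by
      have := mul_le_mul_of_nonneg_right hαL hL0'.le
      calc 106 * (L : ℝ) = (1 / 10) * (1060 * L) := by ring
        _ ≤ (1 / 10) * (α * L * L) := by linarith
        _ = α / 10 * (L : ℝ) ^ 2 := by ring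
    rw [hsplit] at hstep1
    linarith
  have hsq : (7 / 10 * α * (L : ℝ) ^ 2) ^ 2 ≤ 4 * (K * W) := by
    have h := pow_le_pow_left₀ (by positivity) hmain 2
    have e : (2 * (Real.sqrt K * Real.sqrt W)) ^ 2 = 4 * (K * W) := by
      rw [mul_pow, mul_pow, Real.sq_sqrt hK0, Real.sq_sqrt hW0]
      norm_num
    rwa [e] at h
  -- Step 4: `W ≤ 1200 ℓ₀² L²`
  have hWle : W ≤ 1200 * ℓ₀ ^ 2 * (L : ℝ) ^ 2 := by
    have hΛ2 : Real.log (4 / e₀) ^ 2 ≤ (15 / 2 * ℓ₀) ^ 2 := pow_le_pow_left₀ hΛ0 hΛ 2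
    -- `70 L/e₀ = 35840 ℓ₀ L/α ≤ 34 ℓ₀ L² ≤ 25 ℓ₀² L²`
    have h70 : 70 * (L : ℝ) / e₀ ≤ 34 * ℓ₀ * (L : ℝ) ^ 2 := by
      have e : 70 * (L : ℝ) / e₀ = 35840 * ℓ₀ * L / α := by
        rw [he₀]
        field_simp
        ring
      rw [e, div_le_iff₀ hα0]
      have h1 : 35840 * (L : ℝ) ≤ 34 * (α * L) * L := by
        have := mul_le_mul_of_nonneg_right hαL hL0'.le
        calc 35840 * (L : ℝ) ≤ 34 * (1060 * L) := by linarith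
          _ ≤ 34 * (α * L * L) := by linarith
          _ = 34 * (α * L) * L := by ring
      have h2 := mul_le_mul_of_nonneg_left h1 hℓ0.le
      have e1 : ℓ₀ * (35840 * (L : ℝ)) = 35840 * ℓ₀ * L := by ring
      have e2 : ℓ₀ * (34 * (α * L) * L) = 34 * ℓ₀ * (L : ℝ) ^ 2 * α := by ring
      rw [e1, e2] at h2
      exact h2
    have h34 : 34 * ℓ₀ * (L : ℝ) ^ 2 ≤ 25 * ℓ₀ ^ 2 * (L : ℝ) ^ 2 := by
      have h25 : (34 : ℝ) ≤ 25 * ℓ₀ := by linarith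
      have h : 34 * ℓ₀ ≤ 25 * ℓ₀ ^ 2 := by
        calc 34 * ℓ₀ ≤ (25 * ℓ₀) * ℓ₀ := mul_le_mul_of_nonneg_right h25 hℓ0.le
          _ = 25 * ℓ₀ ^ 2 := by ring
      have := mul_le_mul_of_nonneg_right h (sq_nonneg (L : ℝ))
      linarith
    have h20 : 20 * (L : ℝ) ^ 2 * Real.log (4 / e₀) ^ 2 ≤ 20 * (L : ℝ) ^ 2 * (15 / 2 * ℓ₀) ^ 2 :=
      mul_le_mul_of_nonneg_left hΛ2 (by positivity)
    have hpos : 0 ≤ ℓ₀ ^ 2 * (L : ℝ) ^ 2 := by positivity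
    calc W = 20 * (L : ℝ) ^ 2 * Real.log (4 / e₀) ^ 2 + 70 * L / e₀ := rfl
      _ ≤ 20 * (L : ℝ) ^ 2 * (15 / 2 * ℓ₀) ^ 2 + 25 * ℓ₀ ^ 2 * (L : ℝ) ^ 2 :=
          add_le_add h20 (h70.trans h34)
      _ = 1150 * (ℓ₀ ^ 2 * (L : ℝ) ^ 2) := by ring
      _ ≤ 1200 * (ℓ₀ ^ 2 * (L : ℝ) ^ 2) := by linarith
      _ = 1200 * ℓ₀ ^ 2 * (L : ℝ) ^ 2 := by ring
  -- Step 5: `49 α² L² ≤ 480000 ℓ₀² K`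
  have hcore : 49 * α ^ 2 * (L : ℝ) ^ 2 ≤ 480000 * ℓ₀ ^ 2 * K := by
    have h1' : (7 / 10 * α * (L : ℝ) ^ 2) ^ 2 ≤ 4 * (K * (1200 * ℓ₀ ^ 2 * (L : ℝ) ^ 2)) :=
      hsq.trans (mul_le_mul_of_nonneg_left (mul_le_mul_of_nonneg_left hWle hK0) (by norm_num))
    have hL2 : (0 : ℝ) < (L : ℝ) ^ 2 := by positivity
    have h3 : 49 * α ^ 2 * (L : ℝ) ^ 2 * (L : ℝ) ^ 2 ≤ 480000 * ℓ₀ ^ 2 * K * (L : ℝ) ^ 2 := by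
      have e2 : (7 / 10 * α * (L : ℝ) ^ 2) ^ 2 = (1 / 100) * (49 * α ^ 2 * (L : ℝ) ^ 2 * (L : ℝ) ^ 2) := by
        ring
      have e3 : 4 * (K * (1200 * ℓ₀ ^ 2 * (L : ℝ) ^ 2)) = (1 / 100) * (480000 * ℓ₀ ^ 2 * K * (L : ℝ) ^ 2) := by
        ring
      rw [e2, e3] at h1'
      linarith
    exact le_of_mul_le_mul_right h3 hL2
  -- conclusion: `a = 8 α²`, `8 · 480000 / 49 ≤ 100000`
  have hfin : a / (100000 * ℓ₀ ^ 2) * (L : ℝ) ^ 2 ≤ K := by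
    rw [div_mul_eq_mul_div, div_le_iff₀ (by positivity)]
    have ha8 : a = 8 * α ^ 2 := by rw [hα2]; ring
    rw [ha8]
    have hℓK : 0 ≤ ℓ₀ ^ 2 * K := mul_nonneg (sq_nonneg _) hK0
    calc 8 * α ^ 2 * (L : ℝ) ^ 2 = (8 / 49) * (49 * α ^ 2 * (L : ℝ) ^ 2) := by ring
      _ ≤ (8 / 49) * (480000 * ℓ₀ ^ 2 * K) := mul_le_mul_of_nonneg_left hcore (by norm_num)
      _ = (3840000 / 49) * (ℓ₀ ^ 2 * K) := by ring
      _ ≤ 100000 * (ℓ₀ ^ 2 * K) := by linarith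
      _ = K * (100000 * ℓ₀ ^ 2) := by ring
  rw [hK] at hfin
  linarith

/-- **Pair LRO of an arbitrary bounded form factor costs kinetic energy (level-uniform rate).** For a real
form factor `ĝ` with `|ĝ| ≤ G`, `G > 0`, a density `q > 0`, `L ≥ 3` with `√(32q/G²)·L ≥ 3200`, and a unit
`ψ ∈ szSector (2n) 0` (any `n`) with `Re ⟨ψ, B(ĝ)†B(ĝ) ψ⟩ ≥ q·L⁴` (`B(ĝ) = pairOperator ĝ univ =
Σ_k ĝ(k) c_{-k↓}c_{k↑}`): with `a := 32q/G²`,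
`minEnergyOn H₀ (szSector (2n) 0) + a/(10⁵·log²(4 + 32/√a))·L² ≤ Re ⟨ψ, H₀ ψ⟩`. (The triangle bound
`sqrt_re_expect_pairOperator_le_deviation` gives `√q·L² ≤ G(Σ_{k∉F}√x_k + Σ_{k∈F}√(1-x_k) + √(Σ_F x_k))`,
i.e. the deviation hypothesis with `√(a/8) = 2√q/G`.) The `d`-wave case is `q = a_d/8`, `G = 2`; the
on-site case `q = a_s/2`, `G = 1`. Bardeen–Cooper–Schrieffer (1957) §II; Yang (1962) §3. [folklore] -/
theorem freePairing_costs_energy_uniform_pairOperator {ĝ : TorusSite 2 L → ℝ} {G q : ℝ}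
    (hG : ∀ k, |ĝ k| ≤ G) (hG0 : 0 < G) (hq : 0 < q) (hL : 3 ≤ L)
    (hLq : 3200 ≤ Real.sqrt (32 * q / G ^ 2) * L) {n : ℕ} {ψ : Fock (Orb (FermionTorus 2 L))}
    (hψ : ψ ∈ szSector (Λ := FermionTorus 2 L) (2 * n) 0) (h1 : star ψ ⬝ᵥ ψ = 1)
    (hQ : q * (L : ℝ) ^ 4 ≤
      (star ψ ⬝ᵥ (((pairOperator ĝ univ)ᴴ * pairOperator ĝ univ) *ᵥ ψ)).re) :
    (hubbardTorus 2 L 1 0).minEnergyOn (szSector (Λ := FermionTorus 2 L) (2 * n) 0) +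
        (32 * q / G ^ 2) / (100000 * Real.log (4 + 32 / Real.sqrt (32 * q / G ^ 2)) ^ 2) *
          (L : ℝ) ^ 2 ≤
      (star ψ ⬝ᵥ (hubbardTorus 2 L 1 0 *ᵥ ψ)).re := by
  have ha : 0 < 32 * q / G ^ 2 := by positivity
  refine freePairing_costs_energy_uniform_of_deviation ha hL hLq hψ h1 fun F => ?_
  have h := sqrt_re_expect_pairOperator_le_deviation hG F h1
  -- `√q · L² ≤ √Q`
  set Q : ℝ := (star ψ ⬝ᵥ (((pairOperator ĝ univ)ᴴ * pairOperator ĝ univ) *ᵥ ψ)).re with hQdef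
  have hL2 : (0 : ℝ) ≤ (L : ℝ) ^ 2 := by positivity
  have hsq : Real.sqrt q * (L : ℝ) ^ 2 ≤ Real.sqrt Q := by
    rw [← Real.sqrt_sq hL2, ← Real.sqrt_mul hq.le]
    exact Real.sqrt_le_sqrt (by nlinarith [hQ])
  -- `√(a/8) = 2 √q / G`
  have hα : Real.sqrt (32 * q / G ^ 2 / 8) = 2 * Real.sqrt q / G := by
    rw [show 32 * q / G ^ 2 / 8 = (2 / G) ^ 2 * q by field_simp; ring,
      Real.sqrt_mul (sq_nonneg _), Real.sqrt_sq (by positivity)]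
    ring
  rw [hα]
  -- divide the triangle bound by `G`
  set S : ℝ := ∑ k ∈ Fᶜ, Real.sqrt ((star ψ ⬝ᵥ (momentumNumber k 0 *ᵥ ψ)).re) +
      ∑ k ∈ F, Real.sqrt (1 - (star ψ ⬝ᵥ (momentumNumber k 0 *ᵥ ψ)).re) +
        Real.sqrt (∑ k ∈ F, (star ψ ⬝ᵥ (momentumNumber k 0 *ᵥ ψ)).re) with hS
  have hGS : Real.sqrt q * (L : ℝ) ^ 2 ≤ G * S := by
    have : G * S = G * ∑ k ∈ Fᶜ, Real.sqrt ((star ψ ⬝ᵥ (momentumNumber k 0 *ᵥ ψ)).re) +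
        G * ∑ k ∈ F, Real.sqrt (1 - (star ψ ⬝ᵥ (momentumNumber k 0 *ᵥ ψ)).re) +
          G * Real.sqrt (∑ k ∈ F, (star ψ ⬝ᵥ (momentumNumber k 0 *ᵥ ψ)).re) := by
      rw [hS]; ring
    rw [this]
    exact hsq.trans h
  have hdiv : Real.sqrt q * (L : ℝ) ^ 2 / G ≤ S := by
    rw [div_le_iff₀ hG0, mul_comm S G]
    exact hGS
  calc 2 * Real.sqrt q / G * (L : ℝ) ^ 2 = 2 * (Real.sqrt q * (L : ℝ) ^ 2 / G) := by ring
    _ ≤ 2 * S := by linarith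
    _ = _ := by rw [hS]; ring

/-- REGISTERED STUB `stub_pairingCostOfDeviation` of crux stmt-HubbardSuperconductivity-0933 (verbatim
signature; a BY-PRODUCT / TOOL — pair LRO of any bounded form factor costs free kinetic energy at the
level-uniform rate — not a piece of a composition `NoOnsiteODLRO_of`):
`= freePairing_costs_energy_uniform_pairOperator`. Bardeen–Cooper–Schrieffer (1957) §II. [folklore] -/
theorem stub_pairingCostOfDeviation :
    open Literature.MathematicalPhysics.QuantumLattice Literature.Probability.LatticeModels in
    ∀ (L : ℕ) [NeZero L] (ĝ : TorusSite 2 L → ℝ) (G q : ℝ), (∀ k, |ĝ k| ≤ G) → 0 < G → 0 < q →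
      3 ≤ L → 3200 ≤ Real.sqrt (32 * q / G ^ 2) * L →
        ∀ (n : ℕ) (ψ : Fock (Orb (FermionTorus 2 L))), ψ ∈ szSector (Λ := FermionTorus 2 L) (2 * n) 0 →
          star ψ ⬝ᵥ ψ = 1 →
            q * (L : ℝ) ^ 4 ≤
                (star ψ ⬝ᵥ (((pairOperator ĝ Finset.univ)ᴴ * pairOperator ĝ Finset.univ) *ᵥ ψ)).re →
              (hubbardTorus 2 L 1 0).minEnergyOn (szSector (Λ := FermionTorus 2 L) (2 * n) 0) +
                  (32 * q / G ^ 2) /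
                      (100000 * Real.log (4 + 32 / Real.sqrt (32 * q / G ^ 2)) ^ 2) * (L : ℝ) ^ 2 ≤
                (star ψ ⬝ᵥ (hubbardTorus 2 L 1 0 *ᵥ ψ)).re :=
  fun _ _ _ _ _ hG hG0 hq hL hLq _ _ hψ h1 hQ =>
    freePairing_costs_energy_uniform_pairOperator hG hG0 hq hL hLq hψ h1 hQ

end Summit.HubbardSuperconductivity.HubbardSuperconductivity.Theorems.NoOnsiteODLRO.OnsiteCeiling
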